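import Literature.MathematicalPhysics.QuantumFieldTheory.Balaban1983to89.B16B10Shape
import Literature.MathematicalPhysics.QuantumFieldTheory.Balaban1983to89.MatrixNorms
import Literature.Barriers.QuantumFields.UnitaryHaarSmallBall

/-!
# `Balaban1983to89.B16ZLower` — the gauge-fixing normalisation `z` of [Balaban1987RG1] (0.15) and the
reader's item `B16B10Shape.CountertermData.ZLower`, DISCHARGED BY A KERNEL THEOREM for `G = U(N)` (v1, exponent
`N²`) and for `G = SU(N)` (v2 §4, the sharp exponent `N² − 1 = dim SU(N)`)

CITATION HEADER (lean-in-tree rule 2026-08-18).  Source: (B12 = [I]) T. Bałaban, *Renormalization group approach to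
lattice gauge field theories. I. Generation of effective actions in a small field approximation and a coupling constant
renormalization in four dimensions*, Commun. Math. Phys. **109**, 249–301 (1987), doi:10.1007/bf01215223, bib
`Balaban1987RG1` (held: `paper:balaban1987-cmp109-rg-i-small-field`; journal page = PDF page + 248).  The quotations
below were READ AS IMAGES on the x2 page renders `…/1987-cmp109-rg-I-small-field-p006-x2.png` (p. 254) and
`…-p007-x2.png` (p. 255) of the cell (`run/shared/lean/pub/pub-balaban/b2b-balaban-ref1/pages/`), not on an OCR layer:

* p. 254 [6], before (0.14): *"Instead we introduce exponential gauge fixing functions,"*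
  (0.14) `exp[−(1/2α)|U(y,x) − 1|²] = exp[−(1/α)[1 − Re tr U(y,x)]]`;
* p. 254 [6], (0.15): *"We have the following identities for y ∈ T⁽¹⁾, x ∈ B(y), x ≠ y,"*
  `(1/z)∫du(x) exp[−(1/α)[1 − Re tr U(y,x)u⁻¹(x)]]χ({|U(y,x)u⁻¹(x) − 1| < ε₀})`
  `= (1/z)∫du(x) exp[−(1/α)[1 − Re tr u(x)]]χ({|u(x) − 1| < ε₀}) = 1,`
  p. 255 [7] l. 1: *"where z is defined by the last integral."*;
* p. 255 [7], (0.16): the factors `(1/z) exp[−(1/α)[1 − Re tr U(y,x)]] χ({|U(y,x) − 1| < ε₀})`, one per `y ∈ T⁽¹⁾`,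
  `x ∈ B(y)`, `x ≠ y`, under the renormalization integral; (0.17)/(0.19): the same exponent with `1/α = 1/g₀²`, resp.
  `1/g_k²` (*"× χ_k exp[−(1/g_k²) Σ_{y∈T^{(k+1)}} Σ_{x∈B(y),x≠y} [1 − Re tr U(y,x)] + A_k(g_k, U)]"*).

Conventions (cell NOTATION.md §3/§7, `Setup`/`UnitaryModel`): `du` = the normalised Haar measure of the gauge group
(`HaarData.haar`), `tr` = the NORMALISED trace (B12 (0.2) p. 252, *"tr 1 = 1"*; `GaugeGroup.reTr`, on matrices
`UnitaryModel.nReTr = Re Tr/N`), `|·|` = the OPERATOR norm (B7 (19) p. 21; `GaugeGroup.dist1`, on matrices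
`UnitaryModel.opDist1 = ‖· − 1‖_{L²-op}`).  (0.14) itself is NOT used (it is an identity only in the normalised
Hilbert–Schmidt norm, `MatrixNorms` FINDING (b)); what is used is its operator-norm half
`2[1 − Re tr U] ≤ |U − 1|²` (`MatrixNorms.two_mul_one_sub_nReTr_le_opDist1_sq`, proved in the tree).

WHAT THIS MODULE DOES (audit cell `pub-balaban`, unit `b2b-balaban-pv24-g2` = SURGE NODE PROVER #24 gen 2, owner
lineage of `B16B10Shape`; journal row ZLOWER-KERNEL; value = a KERNEL CERTIFICATE of a reader's item, NOT summit
progress; nothing of the series is asserted).  `B16B10Shape.CountertermData.ZLower Cz` (§4 there) is the READER'S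
ITEM *"log z ≥ d(𝔤)·log g_j − C_z"* for the normalisation `z` of (0.15) at `α = g_j²`, entered there as a HYPOTHESIS
of `negE_lower` / `unitConfigLog_of_leaves` / `ep_lower_of_leaves`.  Here:

* §1 — `zNorm G α ε₀ := ∫_{ {u : |u − 1| < ε₀} } exp[−(1/α)(1 − Re tr u)] du` over an ABSTRACT gauge group
  (`GaugeGroup` + `HaarData` of `Setup`), i.e. literally *"the last integral"* of (0.15); the elementary LAPLACE LOWER
  BOUND `zNorm ≥ e^{−c/α}·Haar(B)` for every measurable `B ⊆ {|u − 1| < ε₀}` on which `1 − Re tr u ≤ c`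
  (`zNorm_ge_of_subset`; the integrand is `≤ 1` because `Re tr u ≤ 1`, so it is integrable against a probability
  measure).
* §2 — `G = U(N)` (`Matrix.unitaryGroup (Fin N) ℂ` with the cell's instances `instGaugeGroupUnitaryGroup`,
  `instHaarDataUnitaryGroup`): with `B` = the operator-norm ball `{‖V − 1‖ ≤ ρ}` and `c = ρ²/2` (operator-norm half
  of (0.14)), the tree's N-UNIFORM HAAR SMALL-BALL BOUND `Literature.Barriers.QuantumFields.haar_unitaryOpBall_ge`
  (`Haar{‖V − 1‖_op ≤ ρ} ≥ (ρ/(2π + ρ))^{N²}`, a covering argument proved from Mathlib in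
  `Literature/Barriers/QuantumFields/UnitaryHaarSmallBall.lean`) gives
  `zNorm ≥ e^{−ρ²/2α}(ρ/(2π + ρ))^{N²}` (`zNorm_unitaryGroup_ge`), and with `α = g²`, `ρ = gε₀/2` (`0 < g ≤ 1`):
  `log zNorm(U(N), g², ε₀) ≥ N²·log g − C_z(N, ε₀)`, `C_z(N, ε₀) := N²·log((4π + ε₀)/ε₀) + ε₀²/8 ≥ 0`
  (`log_zNorm_unitaryGroup_ge`, `Cz`, `Cz_nonneg`) — the exponent `N² = dim U(N) = d(𝔲(N))` is the sharp one.
* §3 — DICTIONARY: for a `CountertermData S` whose `logz j` IS `log zNorm(U(N), (g j)², ε₀)` (the reader's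
  identification `α = g_j²` of (0.17)/(0.19), exactly as in the docstring of `ZLower`), `dg = N²` and
  `SmallCouplings` (`0 < g_j ≤ 1`), the item holds: `S.ZLower (Cz N ε₀)` (`zLower_of_unitaryGroup`).  So for
  `G = U(N)` the hypothesis `hz : S.ZLower Cz` of `B16B10Shape.negE_lower` is no longer a reader's item but a theorem,
  and `hCz : 0 ≤ 4|log σ₀| + Cz` holds by `Cz_nonneg`.
* §4 (v2, pure append) — `G = SU(N)` (`Matrix.specialUnitaryGroup (Fin N) ℂ`, cell instances
  `instGaugeGroupSpecialUnitaryGroup`, `instHaarDataSpecialUnitaryGroup`), with the SHARP exponent `N² − 1`: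
  (4a) coordinates — the identity direction `dOne` (`uHerm dOne = 1`) and the diagonal sum `diagSum x = Σ x(i,i)`
  (`= tr uHerm x`), and the KEY SEPARATION `|s| ≤ uOpNorm (a + s·dOne)` for traceless `a`
  (`abs_le_uOpNorm_add_smul_dOne`: a diagonal entry has the sign of `s`); (4b) `det e^{iH} = e^{i tr H}` for Hermitian
  `H` (`det_exp_I_smul_of_isHermitian`, from Mathlib's spectral theorem `Matrix.IsHermitian.spectral_theorem` +
  `Matrix.exp_units_conj` + `Matrix.exp_diagonal`) and the PHASE DECOMPOSITION of `SU(N)`: every `W ∈ SU(N)` is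
  `e^{2πik/N}·e^{i uHerm x₀}` with `k ∈ [−N, N]`, `x₀` traceless, `uOpNorm x₀ ≤ 2π`
  (`exists_suPhase_smul_expHermUnitary`; `det W = 1` quantises `Σ x(i,i) ∈ 2πℤ`); (4c) the TRACELESS PACKING BOUND
  `#F ≤ (ρ/R)·((4R + ρ)/ρ)^{N²}` for `ρ`-separated traceless `F ⊂ {uOpNorm ≤ R}` (`card_le_of_traceless_separated`:
  the shifted copies `y + jρ·dOne`, `0 ≤ j ≤ ⌊R/ρ⌋`, are `ρ`-separated in the full space by the key separation, so the
  tree's full-space bound `card_le_of_uOpNorm_separated` applies to `#F·(⌊R/ρ⌋ + 1)` points) and the traceless nets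
  `exists_traceless_net`; (4d) `Haar_{SU(N)}{‖V − 1‖_op ≤ r} ≥ (4π/((2N + 1)r))·(r/(16π + r))^{N²}`
  (`haarReal_suOpBall_ge`: the `(2N + 1)·#F` pieces `{‖W − e^{2πik/N}e^{i uHerm y}‖ ≤ r/2}` cover `SU(N)` and each lies
  in a left translate of the `r`-ball — no `SU(N)`-valued centres needed); (4e) `zNorm_specialUnitaryGroup_ge`,
  `log zNorm(SU(N), g², ε₀) ≥ (N² − 1)·log g − C_z^{SU}(N, ε₀)` with
  `C_z^{SU}(N, ε₀) := N²·log((32π + ε₀)/ε₀) + log(ε₀(2N + 1)/(8π)) + ε₀²/8 ≥ 0` (`log_zNorm_specialUnitaryGroup_ge`,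
  `CzSU`, `CzSU_nonneg`); (4f) DICTIONARY `zLower_of_specialUnitaryGroup`: `SmallCouplings`, `dg = N·N − 1` and
  `logz j = log zNorm(SU(N), (g j)², ε₀)` give `S.ZLower (CzSU N ε₀)`.

SCOPE, stated honestly.  The series' group clause, B12 pp. 251–252 verbatim (v2.1: quotation made verbatim per the
cross-read GAPS C-ref5-45 V1; v2 carried a paraphrase in quotation marks here): «Field configurations have values in a
compact Lie group G. For definitions concerning Lie groups and algebras see [71]. We assume that G is semisimple and
that it is a Lie subgroup of a group of complex unitary matrices, for example G ⊂ U(N). (In fact a bigger part of our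
considerations does not depend on the semisimplicity assumption.)»; B12 Thm 2 is stated with `G = SU(2)`.  `U(N)` is
not semisimple (the printed parenthetical is the only licence for it), so §2–§3 (v1) discharge the item for the
AMBIENT group only, and §4 (v2) discharges it for `G = SU(N)`, `N ≥ 1`, with `dg = N² − 1 = d(𝔰𝔲(N))` — in particular
for the `SU(2)` of B12 Thm 2 (`dg = 3`).  For a general closed subgroup `G ⊂ U(N)` the same Laplace step applies
verbatim (§1 is abstract), and the only missing input is the Haar small-ball bound ON `G` with the exponent `d(𝔤)`,
`Haar_G{|u − 1| ≤ ρ} ≥ c_G·ρ^{d(𝔤)}`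
(a Lie-chart statement Mathlib does not yet offer in general; NOT claimed here beyond `U(N)` and `SU(N)`).  The constants
`C_z`, `C_z^{SU}` are explicit but not optimised.  Nothing here touches a disputed step of the series: (0.14)–(0.19) are
definitions/conventions, and the bounds are reader's mathematics proved in the kernel.

ABSOLUTE RULE.  No internally-minted statement enters as a cited fact: every `theorem` below is kernel-proved from
Mathlib + the tree (`UnitaryHaarSmallBall`, `MatrixNorms`, `UnitaryModel`, `Setup`); the only [cite] tag marks the
DEFINITION transcribing (0.15); B12's disputed steps are not used.  Companion: GAPS rows C-pv24g2-1, C-pv24g2-2,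
C-pv24g2-3 (cross-reads C-ref5-42b, C-ref5-45), journal CLAIMS.log `ZLOWER-KERNEL`, `DOCFIX-B16ZLower-v2.1`, HANDOFF.md
§ b2b-balaban-pv24 gen 2.
-/

open _root_.MeasureTheory
open scoped BigOperators Matrix ENNReal

namespace Literature.MathematicalPhysics.QuantumFieldTheory.Balaban1983to89

namespace B16ZLower

open Literature.MathematicalPhysics.QuantumFieldTheory.Balaban1983to89
open UnitaryModel MatrixNorms

/-! ## 1. The normalisation `z` of B12 (0.15) over an abstract gauge group, and its Laplace lower bound -/

section General

variable {G : Type*} [GaugeGroup G]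

/-- The gauge-fixing integrand `exp[−(1/α)(1 − Re tr u)]` of (0.15) is `≥ 0`. [folklore] -/
theorem gaugeFixIntegrand_nonneg (α : ℝ) (u : G) : 0 ≤ Real.exp (-(1 / α) * (1 - reTr u)) :=
  Real.exp_nonneg _

/-- For `α > 0` the integrand of (0.15) is `≤ 1`, because `Re tr u ≤ 1` (`GaugeGroup.reTr_le_one`, B12 (0.2)).
[folklore] -/
theorem gaugeFixIntegrand_le_one {α : ℝ} (hα : 0 < α) (u : G) :
    Real.exp (-(1 / α) * (1 - reTr u)) ≤ 1 := by
  rw [Real.exp_le_one_iff]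
  have h1 : 0 ≤ 1 - reTr u := sub_nonneg.2 (GaugeGroup.reTr_le_one u)
  have h2 : 0 ≤ 1 / α := by positivity
  nlinarith

variable [MeasurableSpace G]

/-- The integrand of (0.15) is measurable on a `RegularGaugeGroup` (`Re tr` measurable). [folklore] -/
theorem measurable_gaugeFixIntegrand [RegularGaugeGroup G] (α : ℝ) :
    Measurable fun u : G => Real.exp (-(1 / α) * (1 - reTr u)) :=
  Real.measurable_exp.comp (measurable_const.mul (measurable_const.sub RegularGaugeGroup.measurable_reTr))

variable (G) in
/-- B12 (0.15) p. 254 / p. 255 l. 1: the gauge-fixing NORMALISATION `z = ∫du exp[−(1/α)[1 − Re tr u]]χ({|u − 1| < ε₀})`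
(*"where z is defined by the last integral"*), `du` = normalised Haar measure of `G` (`HaarData.haar`), `tr` normalised,
`|·|` the operator-norm distance `dist1`; typed as the set integral over `{u : |u − 1| < ε₀}`.  In the k-th step
`α = g_k²` ((0.17)/(0.19)).  A transcription of a printed DEFINITION. [cite: Balaban1987RG1, (0.15) p.254] -/
noncomputable def zNorm [HaarData G] (α ε₀ : ℝ) : ℝ :=
  ∫ u in {u : G | dist1 u < ε₀}, Real.exp (-(1 / α) * (1 - reTr u)) ∂(HaarData.haar : Measure G)

variable [HaarData G]

/-- `z ≥ 0`. [folklore] -/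
theorem zNorm_nonneg (α ε₀ : ℝ) : 0 ≤ zNorm G α ε₀ :=
  integral_nonneg fun u => gaugeFixIntegrand_nonneg α u

/-- **Laplace lower bound (abstract group).**  If `B ⊆ {|u − 1| < ε₀}` is measurable and `1 − Re tr u ≤ c` on `B`,
then `z(α, ε₀) ≥ e^{−c/α}·Haar(B)` for `α > 0`: restrict the integral of the non-negative integrand to `B` and bound
the integrand below there (integrability from `0 ≤ integrand ≤ 1` against the probability measure `HaarData.haar`).
Reader's elementary estimate, kernel-proved. [folklore] -/
theorem zNorm_ge_of_subset [RegularGaugeGroup G] {α ε₀ c : ℝ} (hα : 0 < α) {B : Set G} (hBm : MeasurableSet B)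
    (hB : B ⊆ {u : G | dist1 u < ε₀}) (hc : ∀ u ∈ B, 1 - reTr u ≤ c) :
    Real.exp (-(c / α)) * (HaarData.haar : Measure G).real B ≤ zNorm G α ε₀ := by
  haveI := HaarData.isProb (G := G)
  set μ : Measure G := HaarData.haar with hμ
  set f : G → ℝ := fun u => Real.exp (-(1 / α) * (1 - reTr u)) with hf
  have hfm : Measurable f := measurable_gaugeFixIntegrand α
  have hfi : Integrable f μ :=
    Integrable.of_bound hfm.aestronglyMeasurable 1 (Filter.Eventually.of_forall fun u => by
      rw [Real.norm_eq_abs, abs_of_nonneg (Real.exp_nonneg _)]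
      exact gaugeFixIntegrand_le_one hα u)
  have h1 : Real.exp (-(c / α)) * μ.real B ≤ ∫ u in B, f u ∂μ := by
    refine setIntegral_ge_of_const_le_real hBm (measure_ne_top μ B) (fun u hu => ?_) hfi.integrableOn
    apply Real.exp_le_exp.2
    have hcu := hc u hu
    have hα' : 0 ≤ 1 / α := by positivity
    have : (1 / α) * (1 - reTr u) ≤ (1 / α) * c := mul_le_mul_of_nonneg_left hcu hα'
    have hcc : (1 / α) * c = c / α := by ring
    linarith
  have h2 : ∫ u in B, f u ∂μ ≤ ∫ u in {u : G | dist1 u < ε₀}, f u ∂μ :=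
    setIntegral_mono_set hfi.integrableOn (Filter.Eventually.of_forall fun u => Real.exp_nonneg _)
      hB.eventuallyLE
  exact h1.trans h2

end General

/-! ## 2. `G = U(N)`: the Laplace bound with the tree's N-uniform Haar small-ball bound -/

section Unitary

open scoped Matrix.Norms.L2Operator
open Literature.Barriers.QuantumFields

variable {N : ℕ} [NeZero N]

/-- On `U(N)` the interface distance is `dist1 V = ‖V − 1‖_{L²-op}` (definitional, `instGaugeGroupUnitaryGroup`).
[folklore] -/
theorem dist1_unitaryGroup (V : Matrix.unitaryGroup (Fin N) ℂ) :
    dist1 V = ‖(V : Matrix (Fin N) (Fin N) ℂ) - 1‖ := rfl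

/-- On `U(N)` the interface trace is `reTr V = Re Tr V / N` (definitional). [folklore] -/
theorem reTr_unitaryGroup (V : Matrix.unitaryGroup (Fin N) ℂ) :
    reTr V = nReTr (V : Matrix (Fin N) (Fin N) ℂ) := rfl

/-- On the operator-norm ball `{‖V − 1‖ ≤ ρ}` of `U(N)`: `1 − Re tr V ≤ ρ²/2` — the operator-norm half
`2[1 − Re tr U] ≤ |U − 1|²` of (0.14) (`MatrixNorms.two_mul_one_sub_nReTr_le_opDist1_sq`). [folklore] -/
theorem one_sub_reTr_le_of_mem_unitaryOpBall {ρ : ℝ} {V : Matrix.unitaryGroup (Fin N) ℂ}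
    (hV : V ∈ unitaryOpBall N ρ) : 1 - reTr V ≤ ρ ^ 2 / 2 := by
  have h := two_mul_one_sub_nReTr_le_opDist1_sq (n := Fin N) V.2
  have hd : opDist1 (V : Matrix (Fin N) (Fin N) ℂ) ≤ ρ := hV
  have hd0 : 0 ≤ opDist1 (V : Matrix (Fin N) (Fin N) ℂ) := opDist1_nonneg _
  have h2 : opDist1 (V : Matrix (Fin N) (Fin N) ℂ) ^ 2 ≤ ρ ^ 2 := pow_le_pow_left₀ hd0 hd 2
  rw [reTr_unitaryGroup]
  linarith

/-- The tree's N-uniform Haar small-ball bound, in real form for the cell's `HaarData` on `U(N)`: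
`Haar{‖V − 1‖ ≤ ρ} ≥ (ρ/(2π + ρ))^{N²}` (`Literature.Barriers.QuantumFields.haar_unitaryOpBall_ge`, applied to the
left-invariant probability measure `HaarData.haar`). [folklore] -/
theorem haarReal_unitaryOpBall_ge {ρ : ℝ} (hρ : 0 < ρ) :
    (ρ / (2 * Real.pi + ρ)) ^ (N * N) ≤
      (HaarData.haar : Measure (Matrix.unitaryGroup (Fin N) ℂ)).real (unitaryOpBall N ρ) := by
  haveI := HaarData.isProb (G := Matrix.unitaryGroup (Fin N) ℂ)
  haveI : (HaarData.haar : Measure (Matrix.unitaryGroup (Fin N) ℂ)).IsMulLeftInvariant :=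
    ⟨HaarData.map_mul_left⟩
  have h := haar_unitaryOpBall_ge (HaarData.haar : Measure (Matrix.unitaryGroup (Fin N) ℂ)) hρ
  rw [measureReal_def]
  exact (ENNReal.ofReal_le_iff_le_toReal (measure_ne_top _ _)).1 h

/-- **Laplace lower bound on `U(N)`**: for `0 < ρ < ε₀` and `α > 0`,
`z(α, ε₀) ≥ e^{−ρ²/(2α)}·(ρ/(2π + ρ))^{N²}` (§1 with `B` = the `ρ`-ball and `c = ρ²/2`). [folklore] -/
theorem zNorm_unitaryGroup_ge {α ε₀ ρ : ℝ} (hα : 0 < α) (hρ : 0 < ρ) (hρε : ρ < ε₀) :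
    Real.exp (-(ρ ^ 2 / 2 / α)) * (ρ / (2 * Real.pi + ρ)) ^ (N * N) ≤
      zNorm (Matrix.unitaryGroup (Fin N) ℂ) α ε₀ := by
  have hsub : unitaryOpBall N ρ ⊆ {V : Matrix.unitaryGroup (Fin N) ℂ | dist1 V < ε₀} := by
    intro V hV
    have hV' : ‖(V : Matrix (Fin N) (Fin N) ℂ) - 1‖ ≤ ρ := hV
    show dist1 V < ε₀
    rw [dist1_unitaryGroup]
    exact lt_of_le_of_lt hV' hρε
  have h1 := zNorm_ge_of_subset (G := Matrix.unitaryGroup (Fin N) ℂ) hα (measurableSet_unitaryOpBall ρ)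
    hsub (fun V hV => one_sub_reTr_le_of_mem_unitaryOpBall hV)
  refine le_trans ?_ h1
  exact mul_le_mul_of_nonneg_left (haarReal_unitaryOpBall_ge hρ) (Real.exp_nonneg _)

/-- The explicit constant of the reader's item for `U(N)`: `C_z(N, ε₀) := N²·log((4π + ε₀)/ε₀) + ε₀²/8` (from
`ρ = gε₀/2`: `N²[log(2π + ρ) − log(ε₀/2)] ≤ N² log((4π + ε₀)/ε₀)` and `ρ²/(2g²) = ε₀²/8`). Reader-chosen. [folklore] -/
noncomputable def Cz (N : ℕ) (ε₀ : ℝ) : ℝ :=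
  ((N * N : ℕ) : ℝ) * Real.log ((4 * Real.pi + ε₀) / ε₀) + ε₀ ^ 2 / 8

/-- `C_z(N, ε₀) ≥ 0` for `ε₀ > 0` (so `hCz` of `B16B10Shape.negE_lower` holds). [folklore] -/
theorem Cz_nonneg (N : ℕ) {ε₀ : ℝ} (hε : 0 < ε₀) : 0 ≤ Cz N ε₀ := by
  unfold Cz
  have h1 : 1 ≤ (4 * Real.pi + ε₀) / ε₀ := by
    rw [le_div_iff₀ hε]
    linarith [Real.pi_pos]
  have h2 : 0 ≤ Real.log ((4 * Real.pi + ε₀) / ε₀) := Real.log_nonneg h1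
  positivity

/-- **The reader's item for `U(N)`, as a theorem**: for `0 < g ≤ 1` and `ε₀ > 0`,
`log z(g², ε₀) ≥ N²·log g − C_z(N, ε₀)` on `U(N)` (take `ρ = gε₀/2 < ε₀` in `zNorm_unitaryGroup_ge` and pass to
logarithms; `N² = dim U(N)`). [folklore] -/
theorem log_zNorm_unitaryGroup_ge {g ε₀ : ℝ} (hg : 0 < g) (hg1 : g ≤ 1) (hε : 0 < ε₀) :
    ((N * N : ℕ) : ℝ) * Real.log g - Cz N ε₀ ≤
      Real.log (zNorm (Matrix.unitaryGroup (Fin N) ℂ) (g ^ 2) ε₀) := by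
  set ρ : ℝ := g * ε₀ / 2 with hρdef
  have hρ : 0 < ρ := by positivity
  have hgε : g * ε₀ ≤ 1 * ε₀ := mul_le_mul_of_nonneg_right hg1 hε.le
  have hρε' : ρ ≤ ε₀ / 2 := by rw [hρdef]; linarith
  have hρε : ρ < ε₀ := by linarith
  have hz := zNorm_unitaryGroup_ge (N := N) (by positivity : 0 < g ^ 2) hρ hρε
  have hL : 0 < Real.exp (-(ρ ^ 2 / 2 / g ^ 2)) * (ρ / (2 * Real.pi + ρ)) ^ (N * N) := by positivity
  refine le_trans ?_ (Real.log_le_log hL hz)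
  rw [Real.log_mul (Real.exp_pos _).ne' (by positivity), Real.log_exp, Real.log_pow,
    Real.log_div hρ.ne' (by positivity)]
  have h1 : ρ ^ 2 / 2 / g ^ 2 = ε₀ ^ 2 / 8 := by
    rw [hρdef]; field_simp; ring
  have h2 : Real.log ρ = Real.log g + Real.log (ε₀ / 2) := by
    rw [hρdef, mul_div_assoc, Real.log_mul hg.ne' (by positivity)]
  have h3 : Real.log (2 * Real.pi + ρ) ≤ Real.log (2 * Real.pi + ε₀ / 2) :=
    Real.log_le_log (by positivity) (by linarith)
  have h4 : Real.log ((4 * Real.pi + ε₀) / ε₀) = Real.log (2 * Real.pi + ε₀ / 2) - Real.log (ε₀ / 2) := by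
    rw [← Real.log_div (by positivity) (by positivity)]
    congr 1
    field_simp
    ring
  have hn : (0 : ℝ) ≤ ((N * N : ℕ) : ℝ) := Nat.cast_nonneg _
  have h5 := mul_le_mul_of_nonneg_left h3 hn
  unfold Cz
  rw [h1, h2, h4]
  linarith

end Unitary

/-! ## 3. Dictionary: the reader's item `B16B10Shape.CountertermData.ZLower` holds for `G = U(N)` -/

section Dictionary

open B16B10Shape

/-- **Dictionary to the reader's item.**  If the `logz` of a `CountertermData` is the logarithm of the (0.15)
normalisation on `U(N)` at `α = g_j²` (the reader's identification recorded in the docstring of `ZLower`: the exponent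
`−(1/g₀²)Σ[1 − Re tr U(y,x)]` of (0.17), `1/g_k²` in (0.19)), `dg = N²` and the couplings lie in `]0, 1]`, then
`ZLower (C_z(N, ε₀))` HOLDS — the hypothesis `hz` of `B16B10Shape.negE_lower` / `unitConfigLog_of_leaves` /
`ep_lower_of_leaves` is discharged for `G = U(N)`.  (For `G = SU(N)`, `d(𝔤) = N² − 1`, see the module header:
OPEN pending the subgroup small-ball bound.) [folklore] -/
theorem zLower_of_unitaryGroup (S : CountertermData) (N : ℕ) [NeZero N] {ε₀ : ℝ} (hε : 0 < ε₀)
    (hg : S.SmallCouplings) (hdg : S.dg = N * N)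
    (hz : ∀ j, j < S.K → S.logz j = Real.log (zNorm (Matrix.unitaryGroup (Fin N) ℂ) (S.g j ^ 2) ε₀)) :
    S.ZLower (Cz N ε₀) := by
  intro j hj
  obtain ⟨hg0, hg1⟩ := hg j hj
  rw [hz j hj, hdg]
  exact log_zNorm_unitaryGroup_ge hg0 hg1 hε

end Dictionary

/-! ## 4. `G = SU(N)`: Haar small balls with the exponent `N² − 1 = dim SU(N)`, and the item -/

section SpecialUnitary

open scoped Matrix.Norms.L2Operator Real
open Literature.Barriers.QuantumFields
open Complex (I)

variable {N : ℕ}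

/-! ### 4a. Coordinates: the identity direction `dOne` and the diagonal sum -/

/-- The coordinate vector of the identity matrix (`uHerm dOne = 1`). [folklore] -/
def dOne : Fin N × Fin N → ℝ := fun p => if p.1 = p.2 then 1 else 0

/-- The diagonal sum `Σ_i x(i,i)` of a coordinate vector (the trace of `uHerm x`). [folklore] -/
def diagSum (x : Fin N × Fin N → ℝ) : ℝ := ∑ i, x (i, i)

/-- `uHerm dOne = 1`. [folklore] -/
theorem uHerm_dOne : uHerm (dOne : Fin N × Fin N → ℝ) = 1 := by
  ext i j
  rcases lt_trichotomy i j with h | h | h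
  · rw [uHerm_apply_lt _ h, Matrix.one_apply_ne h.ne]
    simp [dOne, h.ne, h.ne']
  · subst h
    rw [uHerm_apply_self, Matrix.one_apply_eq]
    simp [dOne]
  · rw [uHerm_apply_gt _ h, Matrix.one_apply_ne h.ne']
    simp [dOne, h.ne, h.ne']

/-- `tr (uHerm x) = Σ_i x(i,i)`. [folklore] -/
theorem trace_uHerm (x : Fin N × Fin N → ℝ) : (uHerm x).trace = (diagSum x : ℂ) := by
  simp only [Matrix.trace, Matrix.diag_apply, uHerm_apply_self, diagSum, Complex.ofReal_sum]

/-- `diagSum` is additive. [folklore] -/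
theorem diagSum_add (x y : Fin N × Fin N → ℝ) : diagSum (x + y) = diagSum x + diagSum y := by
  simp only [diagSum, Pi.add_apply, Finset.sum_add_distrib]

/-- `diagSum` is homogeneous. [folklore] -/
theorem diagSum_smul (c : ℝ) (x : Fin N × Fin N → ℝ) : diagSum (c • x) = c * diagSum x := by
  simp only [diagSum, Pi.smul_apply, smul_eq_mul, Finset.mul_sum]

/-- `diagSum` respects subtraction. [folklore] -/
theorem diagSum_sub (x y : Fin N × Fin N → ℝ) : diagSum (x - y) = diagSum x - diagSum y := by
  simp only [diagSum, Pi.sub_apply, Finset.sum_sub_distrib]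

/-- `diagSum dOne = N`. [folklore] -/
theorem diagSum_dOne : diagSum (dOne : Fin N × Fin N → ℝ) = N := by
  simp [diagSum, dOne]

/-- `|Σ_i x(i,i)| ≤ N·uOpNorm x` (each coordinate is bounded by the operator norm). [folklore] -/
theorem abs_diagSum_le (x : Fin N × Fin N → ℝ) : |diagSum x| ≤ N * uOpNorm x := by
  calc |diagSum x| ≤ ∑ i, |x (i, i)| := Finset.abs_sum_le_sum_abs _ _
    _ ≤ ∑ _i : Fin N, uOpNorm x := Finset.sum_le_sum fun i _ => abs_uCoord_le_uOpNorm x (i, i)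
    _ = N * uOpNorm x := by simp

/-! ### 4b. `det e^{iH} = e^{i tr H}` for Hermitian `H`, and the phase decomposition of `SU(N)` -/

/-- **`det e^{iH} = e^{i tr H}`** for a Hermitian matrix `H` (unitary diagonalisation
`H = U·diag(λ)·U⋆`, `e^{iH} = U·diag(e^{iλ})·U⋆`, `det = Π e^{iλ_j} = e^{i Σ λ_j}`). [folklore] -/
theorem det_exp_I_smul_of_isHermitian {H : Matrix (Fin N) (Fin N) ℂ} (hH : H.IsHermitian) :
    (NormedSpace.exp (I • H)).det = Complex.exp (I * H.trace) := by
  set U : Matrix.unitaryGroup (Fin N) ℂ := hH.eigenvectorUnitary with hUdef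
  set D : Matrix (Fin N) (Fin N) ℂ := Matrix.diagonal (RCLike.ofReal ∘ hH.eigenvalues) with hDdef
  have hspec : H = (U : Matrix (Fin N) (Fin N) ℂ) * D *
      ((star U : Matrix.unitaryGroup (Fin N) ℂ) : Matrix (Fin N) (Fin N) ℂ) := by
    have h := hH.spectral_theorem
    rwa [Unitary.conjStarAlgAut_apply] at h
  set u : (Matrix (Fin N) (Fin N) ℂ)ˣ := Unitary.toUnits U with hudef
  have hu1 : (u : Matrix (Fin N) (Fin N) ℂ) = (U : Matrix (Fin N) (Fin N) ℂ) := rfl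
  have hu2 : ((u⁻¹ : (Matrix (Fin N) (Fin N) ℂ)ˣ) : Matrix (Fin N) (Fin N) ℂ) =
      ((star U : Matrix.unitaryGroup (Fin N) ℂ) : Matrix (Fin N) (Fin N) ℂ) := rfl
  have h1 : I • H = (u : Matrix (Fin N) (Fin N) ℂ) * (I • D) *
      ((u⁻¹ : (Matrix (Fin N) (Fin N) ℂ)ˣ) : Matrix (Fin N) (Fin N) ℂ) := by
    rw [hu1, hu2, Matrix.mul_smul, Matrix.smul_mul, ← hspec]
  rw [h1, Matrix.exp_units_conj, Matrix.det_units_conj]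
  have h2 : I • D = Matrix.diagonal (fun i => I * (RCLike.ofReal (hH.eigenvalues i) : ℂ)) := by
    rw [hDdef, ← Matrix.diagonal_smul]
    rfl
  rw [h2, Matrix.exp_diagonal, Matrix.det_diagonal]
  simp only [Pi.coe_exp]
  rw [← Complex.exp_eq_exp_ℂ, ← Complex.exp_sum, ← Finset.mul_sum, ← hH.trace_eq_sum_eigenvalues]

/-- The underlying matrix of `expHermUnitary x` is `e^{i uHerm x}` (unfolding). [folklore] -/
theorem coe_expHermUnitary (x : Fin N × Fin N → ℝ) :
    ((expHermUnitary x : Matrix.unitaryGroup (Fin N) ℂ) : Matrix (Fin N) (Fin N) ℂ) =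
      NormedSpace.exp (I • uHerm x) := rfl

/-- `det e^{i uHerm x} = e^{i Σ_i x(i,i)}`. [folklore] -/
theorem det_expHermUnitary (x : Fin N × Fin N → ℝ) :
    ((expHermUnitary x : Matrix.unitaryGroup (Fin N) ℂ) : Matrix (Fin N) (Fin N) ℂ).det =
      Complex.exp (I * (diagSum x : ℂ)) := by
  rw [coe_expHermUnitary, det_exp_I_smul_of_isHermitian (uHerm_isHermitian x), trace_uHerm]

/-- Splitting off the identity direction: `e^{i uHerm(y + t·dOne)} = e^{it}·e^{i uHerm y}` (the scalar
part commutes with everything). [folklore] -/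
theorem exp_I_smul_uHerm_add_smul_dOne (y : Fin N × Fin N → ℝ) (t : ℝ) :
    NormedSpace.exp (I • uHerm (y + t • dOne)) =
      Complex.exp ((t : ℂ) * I) • NormedSpace.exp (I • uHerm y) := by
  rw [uHerm_add, uHerm_smul, uHerm_dOne, smul_add]
  have hcomm : Commute (I • uHerm y) (I • (t • (1 : Matrix (Fin N) (Fin N) ℂ))) :=
    ((Commute.one_right _).smul_right t).smul_right I
  rw [Matrix.exp_add_of_commute _ _ hcomm]
  have hscal : I • (t • (1 : Matrix (Fin N) (Fin N) ℂ)) =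
      algebraMap ℂ (Matrix (Fin N) (Fin N) ℂ) ((t : ℂ) * I) := by
    rw [Algebra.algebraMap_eq_smul_one, RCLike.real_smul_eq_coe_smul (K := ℂ), smul_smul, mul_comm]
    rfl
  rw [hscal, ← NormedSpace.algebraMap_exp_comm, Algebra.algebraMap_eq_smul_one, Matrix.mul_smul,
    mul_one, ← Complex.exp_eq_exp_ℂ]

/-- The phases `e^{2πik/N}` (`N`-th roots of unity for `k ∈ ℤ`). [folklore] -/
noncomputable def suPhase (N : ℕ) (k : ℤ) : ℂ := Complex.exp (((2 * π * k / N : ℝ) : ℂ) * I)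

/-- `|e^{2πik/N}| = 1`. [folklore] -/
theorem norm_suPhase (k : ℤ) : ‖suPhase N k‖ = 1 := by
  unfold suPhase
  exact Complex.norm_exp_ofReal_mul_I _

variable [NeZero N]

/-- `uOpNorm dOne = ‖1‖ = 1`. [folklore] -/
theorem uOpNorm_dOne : uOpNorm (dOne : Fin N × Fin N → ℝ) = 1 := by
  rw [uOpNorm, uHerm_dOne, norm_one]

/-- **Key separation estimate.**  For a TRACELESS coordinate vector `a` and a real `s`:
`|s| ≤ uOpNorm (a + s·dOne)` — the diagonal entries `a(i,i) + s` of `uHerm (a + s·dOne)` are bounded by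
the operator norm, and since the `a(i,i)` sum to zero one of them has the sign of `s`. [folklore] -/
theorem abs_le_uOpNorm_add_smul_dOne {a : Fin N × Fin N → ℝ} (ha : diagSum a = 0) (s : ℝ) :
    |s| ≤ uOpNorm (a + s • dOne) := by
  have hent : ∀ i, |a (i, i) + s| ≤ uOpNorm (a + s • dOne) := by
    intro i
    have h := norm_entry_le_l2_opNorm (uHerm (a + s • dOne)) i i
    have hdiag : uHerm (a + s • dOne) i i = ((a (i, i) + s : ℝ) : ℂ) := by
      rw [uHerm_apply_self]; simp [dOne]
    rw [hdiag, Complex.norm_real, Real.norm_eq_abs] at h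
    exact h
  have hsum : ∑ i, a (i, i) = 0 := ha
  rcases le_total 0 s with hs | hs
  · obtain ⟨i, -, hi⟩ : ∃ i ∈ (Finset.univ : Finset (Fin N)), (fun _ => (0 : ℝ)) i ≤ a (i, i) :=
      Finset.exists_le_of_sum_le Finset.univ_nonempty (by simp [hsum])
    have hi' : (0 : ℝ) ≤ a (i, i) := hi
    calc |s| = s := abs_of_nonneg hs
      _ ≤ |a (i, i) + s| := by rw [abs_of_nonneg (by linarith)]; linarith
      _ ≤ _ := hent i
  · obtain ⟨i, -, hi⟩ : ∃ i ∈ (Finset.univ : Finset (Fin N)), a (i, i) ≤ (fun _ => (0 : ℝ)) i :=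
      Finset.exists_le_of_sum_le Finset.univ_nonempty (by simp [hsum])
    have hi' : a (i, i) ≤ 0 := hi
    calc |s| = -s := abs_of_nonpos hs
      _ ≤ |a (i, i) + s| := by rw [abs_of_nonpos (by linarith)]; linarith
      _ ≤ _ := hent i

/-- **Phase decomposition of `SU(N)`.**  Every `W ∈ SU(N)` is `e^{2πik/N}·e^{i uHerm x₀}` with
`k ∈ [−N, N]`, `x₀` TRACELESS and `uOpNorm x₀ ≤ 2π`: write `W = e^{i uHerm x}` with `uOpNorm x ≤ π`
(`exists_uCoords_eq`); `det W = 1` and `det e^{i uHerm x} = e^{i Σ x(i,i)}` force `Σ x(i,i) = 2πk`,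
`|2πk| ≤ Nπ`; put `x₀ := x − (2πk/N)·dOne`. [folklore] -/
theorem exists_suPhase_smul_expHermUnitary (W : Matrix.specialUnitaryGroup (Fin N) ℂ) :
    ∃ k ∈ Finset.Icc (-(N : ℤ)) N, ∃ x₀ : Fin N × Fin N → ℝ, diagSum x₀ = 0 ∧ uOpNorm x₀ ≤ 2 * π ∧
      (W : Matrix (Fin N) (Fin N) ℂ) =
        suPhase N k • ((expHermUnitary x₀ : Matrix.unitaryGroup (Fin N) ℂ) : Matrix (Fin N) (Fin N) ℂ) := by
  obtain ⟨hWu, hWdet⟩ := Matrix.mem_specialUnitaryGroup_iff.1 W.2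
  obtain ⟨x, hxπ, hxW⟩ :=
    exists_uCoords_eq (⟨(W : Matrix (Fin N) (Fin N) ℂ), hWu⟩ : Matrix.unitaryGroup (Fin N) ℂ)
  have hxW' : ((expHermUnitary x : Matrix.unitaryGroup (Fin N) ℂ) : Matrix (Fin N) (Fin N) ℂ) =
      (W : Matrix (Fin N) (Fin N) ℂ) := congrArg Subtype.val hxW
  have hdet : Complex.exp (I * (diagSum x : ℂ)) = 1 := by
    rw [← det_expHermUnitary, hxW', hWdet]
  obtain ⟨k, hk⟩ := Complex.exp_eq_one_iff.1 hdet
  have hsum : diagSum x = 2 * π * k := by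
    have h := congrArg Complex.im hk
    simp at h
    linarith
  have hNpos : (0 : ℝ) < N := Nat.cast_pos.2 (Nat.pos_of_ne_zero (NeZero.ne N))
  have habs : 2 * π * |(k : ℝ)| ≤ N * π := by
    have h1 : |diagSum x| ≤ N * π :=
      (abs_diagSum_le x).trans (mul_le_mul_of_nonneg_left hxπ (Nat.cast_nonneg _))
    rwa [hsum, abs_mul, abs_of_pos Real.two_pi_pos] at h1
  have hkN : |(k : ℝ)| ≤ N := by nlinarith [Real.pi_pos, abs_nonneg (k : ℝ)]
  have ht : |(2 * π * k / N : ℝ)| ≤ π := by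
    rw [abs_div, abs_of_pos hNpos, div_le_iff₀ hNpos, abs_mul, abs_of_pos Real.two_pi_pos]
    linarith
  refine ⟨k, ?_, x - (2 * π * k / N : ℝ) • dOne, ?_, ?_, ?_⟩
  · obtain ⟨h1, h2⟩ := abs_le.1 hkN
    exact Finset.mem_Icc.2 ⟨by exact_mod_cast h1, by exact_mod_cast h2⟩
  · rw [diagSum_sub, diagSum_smul, diagSum_dOne, hsum]
    field_simp
    ring
  · calc uOpNorm (x - (2 * π * k / N : ℝ) • dOne)
        ≤ uOpNorm x + uOpNorm (-((2 * π * k / N : ℝ) • dOne)) := by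
          rw [sub_eq_add_neg]; exact uOpNorm_add_le _ _
      _ = uOpNorm x + |(2 * π * k / N : ℝ)| := by
          rw [← neg_smul, uOpNorm_smul, uOpNorm_dOne, mul_one, abs_neg]
      _ ≤ π + π := add_le_add hxπ ht
      _ = 2 * π := by ring
  · rw [← hxW', coe_expHermUnitary, coe_expHermUnitary]
    conv_lhs => rw [← sub_add_cancel x ((2 * π * k / N : ℝ) • dOne)]
    rw [exp_I_smul_uHerm_add_smul_dOne]
    rfl

/-! ### 4c. Nets of the traceless coordinates: the exponent `N² − 1` -/

/-- The transversal shift `(y, j) ↦ y + (jρ)·dOne` (product-net device). [folklore] -/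
def dShift (ρ : ℝ) (p : (Fin N × Fin N → ℝ) × ℕ) : Fin N × Fin N → ℝ := p.1 + ((p.2 : ℝ) * ρ) • dOne

/-- **Packing bound for traceless separated sets.**  A `ρ`-separated finite set of TRACELESS coordinate
vectors in `{uOpNorm ≤ R}` has at most `(ρ/R)·((4R + ρ)/ρ)^{N²}` elements — one power of `ρ` better than
the full-space bound `card_le_of_uOpNorm_separated`: the shifted copies `y + jρ·dOne`, `0 ≤ j ≤ ⌊R/ρ⌋`,
form a `ρ`-separated set of `#F·(⌊R/ρ⌋ + 1)` points in `{uOpNorm ≤ 2R}` (separation across different `j`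
by `abs_le_uOpNorm_add_smul_dOne`), to which the full-space bound applies. [folklore] -/
theorem card_le_of_traceless_separated {R ρ : ℝ} (hR : 0 < R) (hρ : 0 < ρ)
    (F : Finset (Fin N × Fin N → ℝ)) (hF0 : ∀ x ∈ F, diagSum x = 0) (hF : ∀ x ∈ F, uOpNorm x ≤ R)
    (hsep : ∀ x ∈ F, ∀ y ∈ F, x ≠ y → ρ ≤ uOpNorm (x - y)) :
    (F.card : ℝ) ≤ ρ / R * ((4 * R + ρ) / ρ) ^ (N * N) := by
  classical
  set M : ℕ := ⌊R / ρ⌋₊ + 1 with hMdef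
  have hRρ : 0 ≤ R / ρ := div_nonneg hR.le hρ.le
  have hM1 : R / ρ < M := by rw [hMdef]; push_cast; exact Nat.lt_floor_add_one _
  have hM2 : (M : ℝ) - 1 ≤ R / ρ := by rw [hMdef]; push_cast; linarith [Nat.floor_le hRρ]
  have hNpos : (0 : ℝ) < N := Nat.cast_pos.2 (Nat.pos_of_ne_zero (NeZero.ne N))
  have hdiag : ∀ p : (Fin N × Fin N → ℝ) × ℕ, p.1 ∈ F → diagSum (dShift ρ p) = (p.2 : ℝ) * ρ * N := by
    intro p hp
    rw [dShift, diagSum_add, diagSum_smul, diagSum_dOne, hF0 _ hp, zero_add]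
  have hinj : Set.InjOn (dShift (N := N) ρ) ↑(F ×ˢ Finset.range M) := by
    intro p hp q hq hpq
    have hp1 : p.1 ∈ F := (Finset.mem_product.1 (Finset.mem_coe.1 hp)).1
    have hq1 : q.1 ∈ F := (Finset.mem_product.1 (Finset.mem_coe.1 hq)).1
    have h2 : p.2 = q.2 := by
      have h := congrArg diagSum hpq
      rw [hdiag p hp1, hdiag q hq1] at h
      exact_mod_cast mul_right_cancel₀ hρ.ne' (mul_right_cancel₀ hNpos.ne' h)
    have h1 : p.1 = q.1 := by
      have h := hpq
      rw [dShift, dShift, h2] at h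
      exact add_right_cancel h
    exact Prod.ext h1 h2
  set P := (F ×ˢ Finset.range M).image (dShift ρ) with hPdef
  have hPcard : P.card = F.card * M := by
    rw [hPdef, Finset.card_image_of_injOn hinj, Finset.card_product, Finset.card_range]
  have hmemP : ∀ z ∈ P, ∃ y ∈ F, ∃ j < M, z = dShift ρ (y, j) := by
    intro z hz
    obtain ⟨p, hp, rfl⟩ := Finset.mem_image.1 hz
    obtain ⟨hp1, hp2⟩ := Finset.mem_product.1 hp
    exact ⟨p.1, hp1, p.2, Finset.mem_range.1 hp2, rfl⟩
  have hPbound : ∀ z ∈ P, uOpNorm z ≤ 2 * R := by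
    intro z hz
    obtain ⟨y, hy, j, hj, rfl⟩ := hmemP z hz
    have hj' : (j : ℝ) ≤ M - 1 := by
      have h1 : j + 1 ≤ M := hj
      have h2 : ((j + 1 : ℕ) : ℝ) ≤ M := by exact_mod_cast h1
      push_cast at h2; linarith
    have hjρ : (j : ℝ) * ρ ≤ R := by
      have h3 : ((M : ℝ) - 1) * ρ ≤ R / ρ * ρ := mul_le_mul_of_nonneg_right hM2 hρ.le
      rw [div_mul_cancel₀ _ hρ.ne'] at h3
      nlinarith
    calc uOpNorm (dShift ρ (y, j)) ≤ uOpNorm y + uOpNorm (((j : ℝ) * ρ) • dOne) := uOpNorm_add_le _ _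
      _ = uOpNorm y + j * ρ := by
          rw [uOpNorm_smul, uOpNorm_dOne, mul_one, abs_of_nonneg (by positivity)]
      _ ≤ R + R := add_le_add (hF y hy) hjρ
      _ = 2 * R := by ring
  have hPsep : ∀ z ∈ P, ∀ z' ∈ P, z ≠ z' → ρ ≤ uOpNorm (z - z') := by
    intro z hz z' hz' hne
    obtain ⟨y, hy, j, hj, rfl⟩ := hmemP z hz
    obtain ⟨y', hy', j', hj', rfl⟩ := hmemP z' hz'
    have hdiff : dShift ρ (y, j) - dShift ρ (y', j') = (y - y') + (((j : ℝ) - j') * ρ) • dOne := by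
      simp only [dShift]
      rw [sub_mul, sub_smul]
      abel
    rw [hdiff]
    by_cases hjj : j = j'
    · subst hjj
      have hyy : y ≠ y' := by
        rintro rfl
        exact hne rfl
      simpa using hsep y hy y' hy' hyy
    · have hone : (1 : ℝ) ≤ |(j : ℝ) - j'| := by
        have hz : ((j : ℤ) - j' : ℤ) ≠ 0 := by omega
        have h := Int.one_le_abs hz
        have h' : ((1 : ℤ) : ℝ) ≤ ((|(j : ℤ) - j'| : ℤ) : ℝ) := by exact_mod_cast h
        simpa [Int.cast_abs, Int.cast_sub] using h'
      calc ρ ≤ |((j : ℝ) - j') * ρ| := by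
            rw [abs_mul, abs_of_pos hρ]
            nlinarith
        _ ≤ uOpNorm ((y - y') + (((j : ℝ) - j') * ρ) • dOne) :=
            abs_le_uOpNorm_add_smul_dOne (by rw [diagSum_sub, hF0 y hy, hF0 y' hy', sub_zero]) _
  have hP := card_le_of_uOpNorm_separated (N := N) (by positivity : (0 : ℝ) ≤ 2 * R) hρ P hPbound hPsep
  rw [hPcard, Nat.cast_mul] at hP
  have hB : ((2 * (2 * R) + ρ) / ρ) ^ (N * N) = ((4 * R + ρ) / ρ) ^ (N * N) := by ring_nf
  rw [hB] at hP
  have hFnn : (0 : ℝ) ≤ F.card := Nat.cast_nonneg _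
  have h3 : (F.card : ℝ) * (R / ρ) ≤ ((4 * R + ρ) / ρ) ^ (N * N) :=
    (mul_le_mul_of_nonneg_left hM1.le hFnn).trans hP
  have h4 : (F.card : ℝ) ≤ ((4 * R + ρ) / ρ) ^ (N * N) / (R / ρ) := (le_div_iff₀ (div_pos hR hρ)).2 h3
  calc (F.card : ℝ) ≤ _ := h4
    _ = ρ / R * ((4 * R + ρ) / ρ) ^ (N * N) := by rw [div_div_eq_mul_div]; ring

/-- **Traceless nets.**  `{x : Σ x(i,i) = 0, uOpNorm x ≤ R}` has a finite `ρ`-net of traceless points with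
at most `(ρ/R)·((4R + ρ)/ρ)^{N²}` elements (a maximal separated subset). [folklore] -/
theorem exists_traceless_net {R ρ : ℝ} (hR : 0 < R) (hρ : 0 < ρ) :
    ∃ F : Finset (Fin N × Fin N → ℝ), (∀ y ∈ F, diagSum y = 0 ∧ uOpNorm y ≤ R) ∧
      (F.card : ℝ) ≤ ρ / R * ((4 * R + ρ) / ρ) ^ (N * N) ∧
      ∀ x, diagSum x = 0 → uOpNorm x ≤ R → ∃ y ∈ F, uOpNorm (x - y) < ρ := by
  classical
  let good : Finset (Fin N × Fin N → ℝ) → Prop := fun F =>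
    (∀ y ∈ F, diagSum y = 0 ∧ uOpNorm y ≤ R) ∧ (∀ x ∈ F, ∀ y ∈ F, x ≠ y → ρ ≤ uOpNorm (x - y))
  have hbound : ∀ F, good F → (F.card : ℝ) ≤ ρ / R * ((4 * R + ρ) / ρ) ^ (N * N) := fun F hF =>
    card_le_of_traceless_separated hR hρ F (fun x hx => (hF.1 x hx).1) (fun x hx => (hF.1 x hx).2) hF.2
  let P : ℕ → Prop := fun k => ∃ F, good F ∧ F.card = k
  set Bd : ℕ := ⌊ρ / R * ((4 * R + ρ) / ρ) ^ (N * N)⌋₊ with hBd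
  have hcard : ∀ F, good F → F.card ≤ Bd := fun F hF => Nat.le_floor (hbound F hF)
  have hP0 : P 0 := ⟨∅, ⟨by simp, by simp⟩, rfl⟩
  set k₀ := Nat.findGreatest P Bd with hk₀
  have hPk₀ : P k₀ := Nat.findGreatest_spec (Nat.zero_le Bd) hP0
  obtain ⟨F₀, hgood, hcardF₀⟩ := hPk₀
  refine ⟨F₀, hgood.1, hbound F₀ hgood, ?_⟩
  intro x hx0 hx
  by_contra hcon
  push Not at hcon
  have hxF : x ∉ F₀ := by
    intro hxF
    have := hcon x hxF
    rw [sub_self, uOpNorm_zero] at this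
    linarith
  have hgood' : good (insert x F₀) := by
    refine ⟨?_, ?_⟩
    · intro y hy
      rcases Finset.mem_insert.1 hy with rfl | hy
      · exact ⟨hx0, hx⟩
      · exact hgood.1 y hy
    · intro a ha b hb hab
      rw [Finset.mem_insert] at ha hb
      rcases ha with ha | ha
      · rcases hb with hb | hb
        · exact absurd (ha.trans hb.symm) hab
        · rw [ha]; exact hcon b hb
      · rcases hb with hb | hb
        · rw [hb, uOpNorm_sub_comm]; exact hcon a ha
        · exact hgood.2 a ha b hb hab
  have hP1 : P (k₀ + 1) :=
    ⟨insert x F₀, hgood', by rw [Finset.card_insert_of_notMem hxF, hcardF₀]⟩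
  have hle : k₀ + 1 ≤ Bd := by
    have := hcard _ hgood'
    rwa [Finset.card_insert_of_notMem hxF, hcardF₀] at this
  exact Nat.findGreatest_is_greatest (Nat.lt_succ_self k₀) hle hP1

/-! ### 4d. Haar measure of operator-norm balls in `SU(N)` -/

/-- The closed operator-norm ball `{V ∈ SU(N) : ‖V − 1‖_op ≤ r}`. [folklore] -/
def suOpBall (N : ℕ) (r : ℝ) : Set (Matrix.specialUnitaryGroup (Fin N) ℂ) :=
  {V | ‖(V : Matrix (Fin N) (Fin N) ℂ) - 1‖ ≤ r}

omit [NeZero N] in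
/-- Membership in the `SU(N)` ball. [folklore] -/
theorem mem_suOpBall {r : ℝ} {V : Matrix.specialUnitaryGroup (Fin N) ℂ} :
    V ∈ suOpBall N r ↔ ‖(V : Matrix (Fin N) (Fin N) ℂ) - 1‖ ≤ r := Iff.rfl

omit [NeZero N] in
/-- The `SU(N)` ball is measurable (closed). [folklore] -/
theorem measurableSet_suOpBall (r : ℝ) : MeasurableSet (suOpBall N r) :=
  (isClosed_le ((continuous_subtype_val.sub continuous_const).norm) continuous_const).measurableSet

omit [NeZero N] in
/-- The inclusion `SU(N) ⊂ U(N)` on elements. [folklore] -/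
def toUnitary (W : Matrix.specialUnitaryGroup (Fin N) ℂ) : Matrix.unitaryGroup (Fin N) ℂ :=
  ⟨W.1, Matrix.specialUnitaryGroup_le_unitaryGroup W.2⟩

omit [NeZero N] in
/-- Left translation in `SU(N)`: `‖V − W‖_op ≤ r` puts `W⁻¹V` in the `r`-ball. [folklore] -/
theorem inv_mul_mem_suOpBall {V W : Matrix.specialUnitaryGroup (Fin N) ℂ} {r : ℝ}
    (h : ‖(V : Matrix (Fin N) (Fin N) ℂ) - (W : Matrix (Fin N) (Fin N) ℂ)‖ ≤ r) :
    W⁻¹ * V ∈ suOpBall N r := by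
  have h1 := inv_mul_mem_unitaryOpBall (U := toUnitary V) (W := toUnitary W) h
  exact h1

/-- **Haar measure of small balls in `SU(N)`, exponent `N² − 1`.**  For `r > 0`,
`Haar_{SU(N)}{‖V − 1‖_op ≤ r} ≥ (4π/((2N + 1)r))·(r/(16π + r))^{N²}` (`= c_N·r^{N²−1}/(16π + r)^{N²}`): by
the phase decomposition and a traceless `r/2`-net `F` of `{uOpNorm ≤ 2π}`, every `W ∈ SU(N)` is within
`r/2` of one of the `(2N + 1)·#F` matrices `e^{2πik/N}e^{i uHerm y}`; each such piece of `SU(N)` lies in a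
left translate of the `r`-ball, so `1 ≤ (2N + 1)·#F·Haar(ball)`. [folklore] -/
theorem haarReal_suOpBall_ge {r : ℝ} (hr : 0 < r) :
    4 * π / ((2 * N + 1) * r) * (r / (16 * π + r)) ^ (N * N) ≤
      (HaarData.haar : Measure (Matrix.specialUnitaryGroup (Fin N) ℂ)).real (suOpBall N r) := by
  classical
  set μ : Measure (Matrix.specialUnitaryGroup (Fin N) ℂ) := HaarData.haar with hμ
  haveI : IsProbabilityMeasure μ := HaarData.isProb
  haveI : μ.IsMulLeftInvariant := ⟨HaarData.map_mul_left⟩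
  have hρ : (0 : ℝ) < r / 2 := by positivity
  obtain ⟨F, hF, hcard, hcov⟩ := exists_traceless_net (N := N) (R := 2 * π) (by positivity) hρ
  let idx : Finset (ℤ × (Fin N × Fin N → ℝ)) := Finset.Icc (-(N : ℤ)) N ×ˢ F
  let ctr : ℤ × (Fin N × Fin N → ℝ) → Matrix (Fin N) (Fin N) ℂ := fun p =>
    suPhase N p.1 • ((expHermUnitary p.2 : Matrix.unitaryGroup (Fin N) ℂ) : Matrix (Fin N) (Fin N) ℂ)
  let piece : ℤ × (Fin N × Fin N → ℝ) → Set (Matrix.specialUnitaryGroup (Fin N) ℂ) := fun p =>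
    {W | ‖(W : Matrix (Fin N) (Fin N) ℂ) - ctr p‖ ≤ r / 2}
  let c : ℤ × (Fin N × Fin N → ℝ) → Matrix.specialUnitaryGroup (Fin N) ℂ := fun p =>
    if h : (piece p).Nonempty then h.some else 1
  have hc : ∀ p, (piece p).Nonempty → c p ∈ piece p := by
    intro p hp
    simp only [c, dif_pos hp]
    exact hp.some_mem
  have hcover : (Set.univ : Set (Matrix.specialUnitaryGroup (Fin N) ℂ)) ⊆
      ⋃ p ∈ idx, (fun V => (c p)⁻¹ * V) ⁻¹' suOpBall N r := by
    intro W _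
    obtain ⟨k, hk, x₀, hx0, hx0π, hW⟩ := exists_suPhase_smul_expHermUnitary W
    obtain ⟨y, hy, hxy⟩ := hcov x₀ hx0 hx0π
    have hp : (k, y) ∈ idx := Finset.mem_product.2 ⟨hk, hy⟩
    have hWp : ‖(W : Matrix (Fin N) (Fin N) ℂ) - ctr (k, y)‖ ≤ r / 2 := by
      show ‖(W : Matrix (Fin N) (Fin N) ℂ) - suPhase N k •
          ((expHermUnitary y : Matrix.unitaryGroup (Fin N) ℂ) : Matrix (Fin N) (Fin N) ℂ)‖ ≤ r / 2
      rw [hW, ← smul_sub, norm_smul, norm_suPhase, one_mul]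
      exact (norm_expHermUnitary_sub_le x₀ y).trans hxy.le
    have hne : (piece (k, y)).Nonempty := ⟨W, hWp⟩
    have hcp : ‖((c (k, y) : Matrix.specialUnitaryGroup (Fin N) ℂ) : Matrix (Fin N) (Fin N) ℂ) -
        ctr (k, y)‖ ≤ r / 2 := hc _ hne
    refine Set.mem_iUnion₂.2 ⟨(k, y), hp, ?_⟩
    show (c (k, y))⁻¹ * W ∈ suOpBall N r
    apply inv_mul_mem_suOpBall
    calc ‖(W : Matrix (Fin N) (Fin N) ℂ) - (c (k, y) : Matrix (Fin N) (Fin N) ℂ)‖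
        ≤ ‖(W : Matrix (Fin N) (Fin N) ℂ) - ctr (k, y)‖ +
            ‖ctr (k, y) - (c (k, y) : Matrix (Fin N) (Fin N) ℂ)‖ := norm_sub_le_norm_sub_add_norm_sub _ _ _
      _ ≤ r / 2 + r / 2 := by rw [norm_sub_rev (ctr (k, y))]; exact add_le_add hWp hcp
      _ = r := by ring
  have h1 : μ Set.univ ≤ ∑ p ∈ idx, μ ((fun V => (c p)⁻¹ * V) ⁻¹' suOpBall N r) :=
    (measure_mono hcover).trans (measure_biUnion_finset_le idx _)
  simp only [measure_preimage_mul, measure_univ, Finset.sum_const, nsmul_eq_mul] at h1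
  have hidx : (idx.card : ℝ) = (2 * N + 1) * F.card := by
    have hI : (Finset.Icc (-(N : ℤ)) N).card = 2 * N + 1 := by
      rw [Int.card_Icc]; omega
    have : idx.card = (2 * N + 1) * F.card := by
      rw [Finset.card_product, hI]
    rw [this]; push_cast; ring
  have hfin : μ (suOpBall N r) ≠ ⊤ := measure_ne_top μ _
  have h2 : (1 : ℝ) ≤ idx.card * μ.real (suOpBall N r) := by
    have h3 : (1 : ℝ≥0∞) ≤ ENNReal.ofReal ((idx.card : ℝ) * μ.real (suOpBall N r)) := by
      rwa [ENNReal.ofReal_mul (Nat.cast_nonneg _), ENNReal.ofReal_natCast, ofReal_measureReal hfin]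
    exact ENNReal.one_le_ofReal.1 h3
  set m := μ.real (suOpBall N r) with hm
  have hm0 : 0 ≤ m := measureReal_nonneg
  set q : ℝ := 4 * π / ((2 * N + 1) * r) * (r / (16 * π + r)) ^ (N * N) with hq
  have hq0 : 0 ≤ q := by positivity
  have hFb : (F.card : ℝ) ≤ r / (4 * π) * ((16 * π + r) / r) ^ (N * N) := by
    have e1 : r / 2 / (2 * π) = r / (4 * π) := by ring
    have e2 : (4 * (2 * π) + r / 2) / (r / 2) = (16 * π + r) / r := by
      field_simp
      ring
    rw [e1, e2] at hcard
    exact hcard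
  have hpow : (r / (16 * π + r)) ^ (N * N) * ((16 * π + r) / r) ^ (N * N) = 1 := by
    rw [← mul_pow, div_mul_div_comm, mul_comm r, div_self (by positivity), one_pow]
  have h2N : (2 * (N : ℝ) + 1) ≠ 0 := by positivity
  have hqidx : q * idx.card ≤ 1 := by
    rw [hidx]
    calc q * ((2 * N + 1) * F.card)
        ≤ q * ((2 * N + 1) * (r / (4 * π) * ((16 * π + r) / r) ^ (N * N))) := by gcongr
      _ = (4 * π / ((2 * N + 1) * r) * ((2 * N + 1) * (r / (4 * π)))) *
            ((r / (16 * π + r)) ^ (N * N) * ((16 * π + r) / r) ^ (N * N)) := by rw [hq]; ring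
      _ = 1 := by
          rw [hpow, mul_one]
          field_simp
  calc q = q * 1 := (mul_one q).symm
    _ ≤ q * (idx.card * m) := mul_le_mul_of_nonneg_left h2 hq0
    _ = (q * idx.card) * m := by ring
    _ ≤ 1 * m := mul_le_mul_of_nonneg_right hqidx hm0
    _ = m := one_mul m

/-! ### 4e. The Laplace bound and the reader's item on `SU(N)` -/

omit [NeZero N] in
/-- On `SU(N)` the interface distance is `dist1 V = ‖V − 1‖_{L²-op}` (definitional). [folklore] -/
theorem dist1_specialUnitaryGroup [NeZero N] (V : Matrix.specialUnitaryGroup (Fin N) ℂ) :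
    dist1 V = ‖(V : Matrix (Fin N) (Fin N) ℂ) - 1‖ := rfl

/-- On `SU(N)` the interface trace is `reTr V = Re Tr V / N` (definitional). [folklore] -/
theorem reTr_specialUnitaryGroup (V : Matrix.specialUnitaryGroup (Fin N) ℂ) :
    reTr V = nReTr (V : Matrix (Fin N) (Fin N) ℂ) := rfl

/-- On the `SU(N)` ball: `1 − Re tr V ≤ r²/2` (operator-norm half of (0.14)). [folklore] -/
theorem one_sub_reTr_le_of_mem_suOpBall {r : ℝ} {V : Matrix.specialUnitaryGroup (Fin N) ℂ}
    (hV : V ∈ suOpBall N r) : 1 - reTr V ≤ r ^ 2 / 2 := by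
  have h := two_mul_one_sub_nReTr_le_opDist1_sq (n := Fin N)
    (Matrix.specialUnitaryGroup_le_unitaryGroup V.2)
  rw [reTr_specialUnitaryGroup]
  have h2 : opDist1 (V : Matrix (Fin N) (Fin N) ℂ) ^ 2 ≤ r ^ 2 :=
    pow_le_pow_left₀ (norm_nonneg _) hV 2
  linarith

/-- **Laplace lower bound on `SU(N)`**: for `0 < r < ε₀` and `α > 0`,
`z(α, ε₀) ≥ e^{−r²/(2α)}·(4π/((2N + 1)r))·(r/(16π + r))^{N²}`. [folklore] -/
theorem zNorm_specialUnitaryGroup_ge {α r ε₀ : ℝ} (hα : 0 < α) (hr : 0 < r) (hrε : r < ε₀) :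
    Real.exp (-(r ^ 2 / 2 / α)) * (4 * π / ((2 * N + 1) * r) * (r / (16 * π + r)) ^ (N * N)) ≤
      zNorm (Matrix.specialUnitaryGroup (Fin N) ℂ) α ε₀ := by
  have hB : suOpBall N r ⊆ {u : Matrix.specialUnitaryGroup (Fin N) ℂ | dist1 u < ε₀} := by
    intro V hV
    show dist1 V < ε₀
    rw [dist1_specialUnitaryGroup]
    exact lt_of_le_of_lt hV hrε
  have hc : ∀ u ∈ suOpBall N r, 1 - reTr u ≤ r ^ 2 / 2 := fun u hu => one_sub_reTr_le_of_mem_suOpBall hu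
  have h := zNorm_ge_of_subset (G := Matrix.specialUnitaryGroup (Fin N) ℂ) hα
    (measurableSet_suOpBall r) hB hc
  refine le_trans ?_ h
  rw [show -(r ^ 2 / 2 / α) = -(r ^ 2 / 2) / α by ring]
  exact mul_le_mul_of_nonneg_left (haarReal_suOpBall_ge hr) (Real.exp_nonneg _)

/-- The explicit constant of the reader's item for `SU(N)`:
`C_z^{SU}(N, ε₀) := N²·log((32π + ε₀)/ε₀) + log(ε₀(2N + 1)/(8π)) + ε₀²/8` (`≥ 0`). Reader-chosen. [folklore] -/
noncomputable def CzSU (N : ℕ) (ε₀ : ℝ) : ℝ :=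
  ((N * N : ℕ) : ℝ) * Real.log ((32 * π + ε₀) / ε₀) + Real.log (ε₀ * (2 * N + 1) / (8 * π)) + ε₀ ^ 2 / 8

/-- `C_z^{SU}(N, ε₀) ≥ 0` for `ε₀ > 0` (since `N² ≥ 1` and `log(32π/ε₀) + log(ε₀(2N+1)/(8π)) = log(4(2N+1))`).
[folklore] -/
theorem CzSU_nonneg {ε₀ : ℝ} (hε : 0 < ε₀) : 0 ≤ CzSU N ε₀ := by
  have hN1 : (1 : ℝ) ≤ N := by
    have := Nat.pos_of_ne_zero (NeZero.ne N)
    exact_mod_cast this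
  have hNN : (1 : ℝ) ≤ ((N * N : ℕ) : ℝ) := by push_cast; nlinarith
  have hπ := Real.pi_pos
  have hA : 32 * π / ε₀ ≤ (32 * π + ε₀) / ε₀ := by
    apply div_le_div_of_nonneg_right _ hε.le
    linarith
  have hApos : 0 < 32 * π / ε₀ := by positivity
  have hL0 : 0 ≤ Real.log ((32 * π + ε₀) / ε₀) := by
    apply Real.log_nonneg
    rw [le_div_iff₀ hε]
    linarith
  have hL1 : Real.log (32 * π / ε₀) ≤ Real.log ((32 * π + ε₀) / ε₀) := Real.log_le_log hApos hA
  have hL2 : Real.log (32 * π / ε₀) + Real.log (ε₀ * (2 * N + 1) / (8 * π)) = Real.log (4 * (2 * N + 1)) := by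
    rw [← Real.log_mul hApos.ne' (by positivity)]
    congr 1
    field_simp
    ring
  have hL3 : 0 ≤ Real.log (4 * (2 * N + 1)) := Real.log_nonneg (by linarith)
  have hL4 : Real.log ((32 * π + ε₀) / ε₀) ≤ ((N * N : ℕ) : ℝ) * Real.log ((32 * π + ε₀) / ε₀) :=
    le_mul_of_one_le_left hL0 hNN
  have hsq : 0 ≤ ε₀ ^ 2 / 8 := by positivity
  unfold CzSU
  linarith

/-- **The reader's item for `SU(N)`, as a theorem**: for `0 < g ≤ 1` and `ε₀ > 0`,
`log z(g², ε₀) ≥ (N² − 1)·log g − C_z^{SU}(N, ε₀)` on `SU(N)` (take `r = gε₀/2 < ε₀` in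
`zNorm_specialUnitaryGroup_ge` and pass to logarithms; `N² − 1 = dim SU(N) = d(𝔰𝔲(N))`). [folklore] -/
theorem log_zNorm_specialUnitaryGroup_ge {g ε₀ : ℝ} (hg : 0 < g) (hg1 : g ≤ 1) (hε : 0 < ε₀) :
    (((N * N : ℕ) : ℝ) - 1) * Real.log g - CzSU N ε₀ ≤
      Real.log (zNorm (Matrix.specialUnitaryGroup (Fin N) ℂ) (g ^ 2) ε₀) := by
  have hπ := Real.pi_pos
  set r : ℝ := g * (ε₀ / 2) with hrdef
  have hr : 0 < r := by positivity
  have hrε : r < ε₀ := by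
    have : g * (ε₀ / 2) ≤ 1 * (ε₀ / 2) := mul_le_mul_of_nonneg_right hg1 (by positivity)
    rw [hrdef]; linarith
  have hrle : r ≤ ε₀ / 2 := by
    have : g * (ε₀ / 2) ≤ 1 * (ε₀ / 2) := mul_le_mul_of_nonneg_right hg1 (by positivity)
    rw [hrdef]; linarith
  have hα : 0 < g ^ 2 := by positivity
  have h := zNorm_specialUnitaryGroup_ge (N := N) hα hr hrε
  have hq : 0 < 4 * π / ((2 * N + 1) * r) * (r / (16 * π + r)) ^ (N * N) := by positivity
  have hlhs : 0 < Real.exp (-(r ^ 2 / 2 / g ^ 2)) * (4 * π / ((2 * N + 1) * r) * (r / (16 * π + r)) ^ (N * N)) :=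
    mul_pos (Real.exp_pos _) hq
  have hlog := Real.log_le_log hlhs h
  refine le_trans ?_ hlog
  have h2N : (0 : ℝ) < 2 * N + 1 := by positivity
  rw [Real.log_mul (Real.exp_pos _).ne' hq.ne', Real.log_exp, Real.log_mul (by positivity) (by positivity),
    Real.log_pow, Real.log_div (by positivity) (by positivity), Real.log_mul h2N.ne' hr.ne',
    Real.log_div hr.ne' (by positivity)]
  have e1 : r ^ 2 / 2 / g ^ 2 = ε₀ ^ 2 / 8 := by
    rw [hrdef]; field_simp; ring
  have e2 : Real.log r = Real.log g + Real.log (ε₀ / 2) := by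
    rw [hrdef, Real.log_mul hg.ne' (by positivity)]
  have e3 : Real.log (16 * π + r) ≤ Real.log (16 * π + ε₀ / 2) :=
    Real.log_le_log (by positivity) (by linarith)
  have e3' : ((N * N : ℕ) : ℝ) * Real.log (16 * π + r) ≤ ((N * N : ℕ) : ℝ) * Real.log (16 * π + ε₀ / 2) :=
    mul_le_mul_of_nonneg_left e3 (Nat.cast_nonneg _)
  have e4 : Real.log ((32 * π + ε₀) / ε₀) = Real.log (16 * π + ε₀ / 2) - Real.log (ε₀ / 2) := by
    rw [← Real.log_div (by positivity) (by positivity)]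
    congr 1
    field_simp
    ring
  have e5 : Real.log (ε₀ * (2 * N + 1) / (8 * π)) = Real.log (ε₀ / 2) + Real.log (2 * N + 1) - Real.log (4 * π) := by
    rw [← Real.log_mul (by positivity) h2N.ne', ← Real.log_div (by positivity) (by positivity)]
    congr 1
    field_simp
    ring
  unfold CzSU
  rw [e1, e2, e4, e5]
  nlinarith [e3', Nat.cast_nonneg (α := ℝ) (N * N)]

end SpecialUnitary

/-! ### 4f. Dictionary: the reader's item `B16B10Shape.CountertermData.ZLower` holds for `G = SU(N)` -/

section DictionarySU

open B16B10Shape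

/-- **Dictionary to the reader's item, `G = SU(N)`.**  If the `logz` of a `CountertermData` is the
logarithm of the (0.15) normalisation on `SU(N)` at `α = g_j²`, `dg = N² − 1 = d(𝔰𝔲(N))` and the couplings
lie in `]0, 1]`, then `ZLower (C_z^{SU}(N, ε₀))` HOLDS — the hypothesis `hz` of `B16B10Shape.negE_lower` /
`unitConfigLog_of_leaves` / `ep_lower_of_leaves` is discharged for the series' groups `G = SU(N)`
(B12 Thm 2: `SU(2)`), with `hCz` from `CzSU_nonneg`. [folklore] -/
theorem zLower_of_specialUnitaryGroup (S : CountertermData) (N : ℕ) [NeZero N] {ε₀ : ℝ} (hε : 0 < ε₀)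
    (hg : S.SmallCouplings) (hdg : S.dg = N * N - 1)
    (hz : ∀ j, j < S.K →
      S.logz j = Real.log (zNorm (Matrix.specialUnitaryGroup (Fin N) ℂ) (S.g j ^ 2) ε₀)) :
    S.ZLower (CzSU N ε₀) := by
  intro j hj
  obtain ⟨hg0, hg1⟩ := hg j hj
  rw [hz j hj, hdg]
  have h1 : 1 ≤ N * N := Nat.one_le_iff_ne_zero.2 (mul_ne_zero (NeZero.ne N) (NeZero.ne N))
  rw [Nat.cast_sub h1, Nat.cast_one]
  exact log_zNorm_specialUnitaryGroup_ge hg0 hg1 hε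

end DictionarySU

end B16ZLower

end Literature.MathematicalPhysics.QuantumFieldTheory.Balaban1983to89
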